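import Summits.BirchSwinnertonDyer.BirchSwinnertonDyer.Theorems.EdixhovenFibreFiveSevenStarredOptimalManinUnitFiveSevenCellsOfSL2NeronValues
import Summits.BirchSwinnertonDyer.BirchSwinnertonDyer.Theorems.EdixhovenFibreFiveSevenStarredOptimalManinUnitFiveSevenSupersingularCellsModels
import HarnessLib

/-!
# Crux K★ `StarredOptimalManinUnitFiveSeven` (stmt-BirchSwinnertonDyer-22226), line `kato-lever`: hDR on the three potentially
# SUPERSINGULAR cells ⟸ the EXPLICIT-MODEL capstone `hR'` (the (R1) target with the three 𝒪_D-models spelled out)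

Cell `pub/bsd-wall`, seat `bsd-line-edix-p1` g16 (unit (R1-MD)). Twin of `…SupersingularCellsDeRham` (hDRss ⟸ `hR`, the capstone
for arbitrary `𝒪_D`-models with unit `Δ` and supersingular reduction of exact height `2`). Here the displayed statement `hR'` hands
the (R1) seat EVERYTHING about the models: `D.poly = X^e − p`, `W_D = ⟨0, 0, 0, a·ϱ^{r₄}, b·ϱ^{r₆}⟩` with `a, b ∈ ℤ_p`,
`(p; e, r₄, r₆, t₄, t₆) ∈ {(5; 3, 1, 0, 1, 0), (5; 6, 4, 0, 2, 0), (7; 4, 0, 2, 0, 1)}`, `3r₄ = e t₄`, `2r₆ = e t₆`, and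
`64a³p^{t₄} + 432b²p^{t₆} ∈ ℤ_pˣ` — from which `Δ(W_D) ∈ 𝒪_Dˣ` (`isUnit_Δ_model`), `A_p = 0` and exact height `2` along every
`𝒪_D → 𝓀_F` (`hasseCoeff_map_model_{five,seven}_eq_zero`, `coeff_sq_formalMul_map_model_ne_zero`) follow, and ALSO the finer
valuations the ω-period non-vanishing (N1′) needs over a ramified base: `A_5(W_D) = 32a·ϱ^{r₄}`, `A_7(W_D) = 192b·ϱ^{r₆}`
(`hasseCoeff_{five,seven}_short`), i.e. `v(A_p) ≥ r/e ∈ {1/3, 2/3, 1/2}` > `1 − (p−1)/e` on all three cells (the (5; II*) cell,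
`e = 6 > p − 1`, is where the bare hypothesis `A_p ≡ 0 (mod ϖ)` would not separate `θ_𝒪(ϖ·A_inf(𝒪))` from the canonical subgroup).

* `isDeRham_adicCompletion_rat_of_model_of_explicitCapstone` — hDR at `ℚ_v` ⟸ `hR'` (any `W/ℚ` with `ord_p j ≥ 0`, numerology);
* `isDeRham_supersingularCells_of_explicitCapstone` — the binder `hDRss` VERBATIM ⟸ `hR'`;
* `starredOptimalManinUnitFiveSeven_of_sl2NeronValues_of_explicitCapstone` — K★ BY NAME ⟸ {P1, hT₂, `hR'`}.

TOOL theorems only; `--supports` 22226; CONDITIONAL; K★ stays OPEN ⟸ {P1, hT₂, hR'} (or hR); BSD is not proved by any of this.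
References: [SilvermanAEC2009] VII.5.5, IV.7.5; [Fontaine1982FormesDifferentielles] §5; [BrinonConrad2009] 6.3.8; [Kato2004Asterisque] (8.1.3).
-/

set_option autoImplicit false
set_option autoImplicit false
-- the Theorems namespace of a single-conjunct summit repeats the summit name by design (D-0017)
set_option linter.dupNamespace false

noncomputable section

open scoped Classical NumberField

open Polynomial WeierstrassCurve NumberField IsDedekindDomain Field ValuativeRel
  Literature.NumberTheory.EllipticCurves Literature.NumberTheory.EllipticCurves.ModularForms
  Literature.NumberTheory.EllipticCurves.Rank1Residual Literature.NumberTheory.EllipticCurves.Kato2004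
  Literature.NumberTheory.DiophantineGeometry Rat.HeightOneSpectrum
  Literature.NumberTheory.PAdicHodge Literature.NumberTheory.GaloisRepresentations
  Literature.NumberTheory.GaloisRepresentations.IsNonarchimedeanLocalField
  Summit.BirchSwinnertonDyer.Rank1Residual.Additive
  Summit.BirchSwinnertonDyer.BirchSwinnertonDyer.Theorems
  Summit.BirchSwinnertonDyer.BirchSwinnertonDyer.Theorems.StarredOptimalManinUnitFiveSevenCellsOfSL2NeronValues
  Summit.BirchSwinnertonDyer.BirchSwinnertonDyer.Theorems.StarredOptimalManinUnitFiveSevenSupersingularCellsModels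

namespace Summit.BirchSwinnertonDyer.BirchSwinnertonDyer.Theorems.StarredOptimalManinUnitFiveSevenSupersingularCellsExplicit

section Capstone

-- `hR'`: the explicit-model ramified good-supersingular capstone (the (R1) target, models spelled out)
variable
  (hR : ∀ {F : Type} [Field F] [ValuativeRel F] [TopologicalSpace F] [IsNonarchimedeanLocalField F] [CharZero F]
    {p : ℕ} [Fact p.Prime] [Fact (¬ IsUnit (p : integerC F))] [IsAdicComplete (Ideal.span {(p : integerC F)}) (integerC F)]
    (hp : valuation F p < 1) [Algebra ℚ_[p] F] (D : EisensteinRoot F p hp) {e : ℕ}, D.poly = X ^ e - C (p : ℤ_[p]) →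
    ∀ {K₀ : Type} [Field K₀] [CharZero K₀] [Algebra K₀ F] (W₀ : WeierstrassCurve K₀) [W₀.IsElliptic]
    (a b : ℤ_[p]) (r₄ r₆ t₄ t₆ : ℕ),
    (p = 5 ∧ (e = 3 ∧ r₄ = 1 ∧ r₆ = 0 ∧ t₄ = 1 ∧ t₆ = 0 ∨ e = 6 ∧ r₄ = 4 ∧ r₆ = 0 ∧ t₄ = 2 ∧ t₆ = 0) ∨
      p = 7 ∧ e = 4 ∧ r₄ = 0 ∧ r₆ = 2 ∧ t₄ = 0 ∧ t₆ = 1) →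
    3 * r₄ = e * t₄ → 2 * r₆ = e * t₆ → IsUnit (64 * a ^ 3 * (p : ℤ_[p]) ^ t₄ + 432 * b ^ 2 * (p : ℤ_[p]) ^ t₆) →
    W₀.baseChange F = (⟨0, 0, 0, AdjoinRoot.of D.poly a * AdjoinRoot.root D.poly ^ r₄,
      AdjoinRoot.of D.poly b * AdjoinRoot.root D.poly ^ r₆⟩ : WeierstrassCurve D.Coeff).map (EisensteinRoot.Coeff.toF D) →
    GaloisRep.IsDeRham (bdRPeriodRingData (F := F) (p := p) hp) (restrictedRationalTateRep W₀ F p))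

variable (W : WeierstrassCurve ℚ) [W.IsElliptic] [W.IsGloballyMinimal] (p : ℕ) [hp : Fact p.Prime]

include hR

/-- **hDR at `ℚ_v` from the explicit 𝒪_D-model, GRANTED the explicit-model capstone `hR'`** (same construction as
`isDeRham_adicCompletion_rat_of_model_of_ramifiedCapstone`; the model data are handed to `hR'` verbatim).
[cite: SilvermanAEC2009, VII.5.5 and IV.7.5] [cite: Fontaine1982FormesDifferentielles, §5] [cite: BrinonConrad2009, Prop. 6.3.8] -/
theorem isDeRham_adicCompletion_rat_of_model_of_explicitCapstone (hp57 : p = 5 ∨ p = 7) (hj : 0 ≤ padicValRat p W.j)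
    {e k m n r₄ r₆ t₄ t₆ : ℕ} (he : 0 < e) (hem : e * m = 4 * k + r₄) (hen : e * n = 6 * k + r₆)
    (h₄ : 3 * r₄ = e * t₄) (h₆ : 2 * r₆ = e * t₆)
    (hm : 3 * m = padicValInt p W.minimalDiscriminantInt + t₄) (hn : 2 * n = padicValInt p W.minimalDiscriminantInt + t₆)
    (ht₄ : t₄ ≤ 2) (ht₆ : t₆ ≤ 1)
    (hcase : p = 5 ∧ (e = 3 ∧ r₄ = 1 ∧ r₆ = 0 ∧ t₄ = 1 ∧ t₆ = 0 ∨ e = 6 ∧ r₄ = 4 ∧ r₆ = 0 ∧ t₄ = 2 ∧ t₆ = 0) ∨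
      p = 7 ∧ e = 4 ∧ r₄ = 0 ∧ r₆ = 2 ∧ t₄ = 0 ∧ t₆ = 1)
    {K' : Type} [Field K'] [NumberField K'] {α : K'} (hαe : α ^ e = (p : K'))
    (v' : HeightOneSpectrum (𝓞 K')) (hv' : (p : 𝓞 K') ∈ v'.asIdeal)
    (v : HeightOneSpectrum (𝓞 ℚ)) (hpv : (p : 𝓞 ℚ) ∈ v.asIdeal)
    [CharZero (v.adicCompletion ℚ)] [Fact (¬ IsUnit (p : integerC (v.adicCompletion ℚ)))]
    [IsAdicComplete (Ideal.span {(p : integerC (v.adicCompletion ℚ))}) (integerC (v.adicCompletion ℚ))]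
    (hp' : valuation (v.adicCompletion ℚ) p < 1) [Algebra ℚ_[p] (v.adicCompletion ℚ)] :
    GaloisRep.IsDeRham (bdRPeriodRingData (F := v.adicCompletion ℚ) (p := p) hp')
      (restrictedRationalTateRep W (v.adicCompletion ℚ) p) := by
  have hpr : p.Prime := hp.out
  have hp5 : 5 ≤ p := by rcases hp57 with rfl | rfl <;> norm_num
  set V := integralModelInt W with hV
  set vΔ := padicValInt p W.minimalDiscriminantInt with hvΔ
  obtain ⟨A, hA⟩ := pow_dvd_c₄_of_padicValRat_j_nonneg W p hj (m := m) (by omega)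
  obtain ⟨B, hB⟩ := pow_dvd_c₆_of_padicValRat_j_nonneg W p hj (n := n) (by omega)
  have hΔ0 : V.Δ ≠ 0 := minimalDiscriminantInt_ne_zero W
  obtain ⟨d, hd⟩ : (p : ℤ) ^ vΔ ∣ V.Δ := (padicValInt_dvd_iff _ _).2 (Or.inr le_rfl)
  have hpd : ¬ (p : ℤ) ∣ d := by
    rintro ⟨d', rfl⟩
    have : (p : ℤ) ^ (vΔ + 1) ∣ V.Δ := ⟨d', by rw [hd, pow_succ]; ring⟩
    rcases (padicValInt_dvd_iff _ _).1 this with h | h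
    · exact hΔ0 h
    · have h' : vΔ + 1 ≤ vΔ := h
      omega
  have hunit : IsUnit (64 * (-27 * (A : ℤ_[p])) ^ 3 * (p : ℤ_[p]) ^ t₄ + 432 * (-54 * (B : ℤ_[p])) ^ 2 * (p : ℤ_[p]) ^ t₆) := by
    have hid := unit_identity (q := (p : ℤ)) (by exact_mod_cast hpr.ne_zero) hA.symm hB.symm hd.symm V.c_relation hm hn
    have hz : ¬ (p : ℤ) ∣ -(6 ^ 12 * d) := by
      rw [dvd_neg]
      intro h
      rcases (Nat.prime_iff_prime_int.mp hpr).dvd_or_dvd h with h6 | h6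
      · have hp6 : (p : ℤ) ∣ 6 := Int.Prime.dvd_pow' hpr h6
        rcases hp57 with rfl | rfl <;> norm_num at hp6
      · exact hpd h6
    have hu : IsUnit (((-(6 ^ 12 * d) : ℤ)) : ℤ_[p]) := by
      rw [PadicInt.isUnit_iff]
      exact le_antisymm (PadicInt.norm_le_one _) (not_lt.1 fun h => hz ((PadicInt.norm_int_lt_one_iff_dvd _).1 h))
    rw [← hid] at hu
    push_cast at hu
    exact hu
  have hα0 : α ≠ 0 := by
    intro h0; rw [h0, zero_pow he.ne'] at hαe; exact (Nat.cast_ne_zero.2 hpr.ne_zero) hαe.symm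
  -- the `K'`-model `S ≅ W ×_ℚ K'`
  set S : WeierstrassCurve K' :=
    ⟨0, 0, 0, -27 * (V.c₄ : K') / (α ^ k) ^ 4, -54 * (V.c₆ : K') / (α ^ k) ^ 6⟩ with hS
  have hWK' : W.baseChange K' = V.map (Int.castRingHom K') := by
    rw [WeierstrassCurve.baseChange, ← map_integralModelInt W, WeierstrassCurve.map_map]
    congr 1
    exact RingHom.ext_int _ _
  have hc4K : (W.baseChange K').c₄ = (V.c₄ : K') := by rw [hWK', WeierstrassCurve.map_c₄, eq_intCast]
  have hc6K : (W.baseChange K').c₆ = (V.c₆ : K') := by rw [hWK', WeierstrassCurve.map_c₆, eq_intCast]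
  have h6 : (6 : K') ≠ 0 := by norm_num
  obtain ⟨C, hC⟩ := exists_variableChange_eq_short (L := K') two_ne_zero three_ne_zero (W.baseChange K')
    (u := α ^ k / 6) (div_ne_zero (pow_ne_zero _ hα0) h6)
  have e4 : -(V.c₄ : K') / (48 * (α ^ k / 6) ^ 4) = -27 * (V.c₄ : K') / (α ^ k) ^ 4 := by
    have : (α ^ k) ≠ 0 := pow_ne_zero _ hα0
    field_simp
    ring
  have e6 : -(V.c₆ : K') / (864 * (α ^ k / 6) ^ 6) = -54 * (V.c₆ : K') / (α ^ k) ^ 6 := by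
    have : (α ^ k) ≠ 0 := pow_ne_zero _ hα0
    field_simp
    ring
  have hC' : C • W.baseChange K' = S := by rw [hC, hS, hc4K, hc6K, e4, e6]
  haveI : S.IsElliptic := hC' ▸ (inferInstance : (C • W.baseChange K').IsElliptic)
  have hiso : IsIsogenous (W.baseChange K') S := isIsogenous_of_smul_eq hC'
  refine isDeRham_restrictedRationalTateRep_adicCompletion_rat_of_isDeRham_isogenous_above W v' hv' S hiso ?_ v hpv hp'
  -- hDR for `S` at `F = K'_{v'}` from the capstone
  intro _ _ _ hpF _
  obtain ⟨ϖ, hϖ⟩ : ∃ ϖ : v'.adicCompletion K', ϖ = algebraMap K' (v'.adicCompletion K') α := ⟨_, rfl⟩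
  have hϖe : ϖ ^ e = (p : v'.adicCompletion K') := by rw [hϖ, ← map_pow, hαe, map_natCast]
  have hϖ0 : ϖ ≠ 0 := by rw [hϖ]; exact (_root_.map_ne_zero _).2 hα0
  obtain ⟨D, hDpoly, hDroot⟩ := EisensteinRoot.exists_poly_eq_X_pow_sub_C hpF he hϖe
  have hroot := D.root_pow_eq_of_poly_eq hDpoly
  have hunit' : IsUnit (64 * (((-27 * A : ℤ) : ℤ_[p])) ^ 3 * (p : ℤ_[p]) ^ t₄ +
      432 * (((-54 * B : ℤ) : ℤ_[p])) ^ 2 * (p : ℤ_[p]) ^ t₆) := by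
    push_cast
    exact hunit
  refine hR hpF D hDpoly S ((-27 * A : ℤ) : ℤ_[p]) ((-54 * B : ℤ) : ℤ_[p]) r₄ r₆ t₄ t₆ hcase h₄ h₆ hunit' ?_
  -- `S ×_{K'} F = W_D ⊗ F`
  rw [map_model_toF, hDroot]
  have hp4 : (ϖ ^ k) ^ 4 * ϖ ^ r₄ = (p : v'.adicCompletion K') ^ m := by
    rw [← pow_mul, ← pow_add, show k * 4 + r₄ = e * m by omega, pow_mul, hϖe]
  have hp6 : (ϖ ^ k) ^ 6 * ϖ ^ r₆ = (p : v'.adicCompletion K') ^ n := by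
    rw [← pow_mul, ← pow_add, show k * 6 + r₆ = e * n by omega, pow_mul, hϖe]
  have hc4F : ((V.c₄ : ℤ) : v'.adicCompletion K') = (ϖ ^ k) ^ 4 * ϖ ^ r₄ * (A : v'.adicCompletion K') := by
    rw [hp4, hA]; push_cast; ring
  have hc6F : ((V.c₆ : ℤ) : v'.adicCompletion K') = (ϖ ^ k) ^ 6 * ϖ ^ r₆ * (B : v'.adicCompletion K') := by
    rw [hp6, hB]; push_cast; ring
  have hϖk : ϖ ^ k ≠ 0 := pow_ne_zero _ hϖ0
  have ha4 : algebraMap K' (v'.adicCompletion K') (-27 * (V.c₄ : K') / (α ^ k) ^ 4) =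
      zpToF hpF ((-27 * A : ℤ) : ℤ_[p]) * ϖ ^ r₄ := by
    rw [map_div₀, map_mul, map_neg, map_ofNat, map_intCast, map_pow, map_pow, ← hϖ, map_intCast, hc4F]
    field_simp
    push_cast
    ring
  have ha6 : algebraMap K' (v'.adicCompletion K') (-54 * (V.c₆ : K') / (α ^ k) ^ 6) =
      zpToF hpF ((-54 * B : ℤ) : ℤ_[p]) * ϖ ^ r₆ := by
    rw [map_div₀, map_mul, map_neg, map_ofNat, map_intCast, map_pow, map_pow, ← hϖ, map_intCast, hc6F]
    field_simp
    push_cast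
    ring
  exact WeierstrassCurve.ext (map_zero _) (map_zero _) (map_zero _) ha4 ha6


end Capstone


/-- **The hDR binder of `…CellsOfSL2NeronValues` on the three potentially supersingular starred cells, VERBATIM, granted `hR'`.**
`(5; IV*)`: `K' = ℚ(5^{1/3})`, `(e,k,m,n,r₄,r₆,t₄,t₆) = (3,2,3,4,1,0,1,0)`; `(5; II*)`: `ℚ(5^{1/6})`, `(6,5,4,5,4,0,2,0)`; `(7; III*)`:
`ℚ(7^{1/4})`, `(4,3,3,5,0,2,0,1)`; `ord_p j ≥ 0`, `ord_p Δ_min ∈ {8, 9, 10}` by `padicValRat_j_nonneg_and_mem_of_starred`.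
[cite: DokchitserDokchitser2015LocalInvariants, Thm. 3.2] [cite: SilvermanAEC2009, VII.5.5] [cite: Fontaine1982FormesDifferentielles, §5] -/
theorem isDeRham_supersingularCells_of_explicitCapstone :
    (∀ {F : Type} [Field F] [ValuativeRel F] [TopologicalSpace F] [IsNonarchimedeanLocalField F] [CharZero F]
      {p : ℕ} [Fact p.Prime] [Fact (¬ IsUnit (p : integerC F))] [IsAdicComplete (Ideal.span {(p : integerC F)}) (integerC F)]
      (hp : valuation F p < 1) [Algebra ℚ_[p] F] (D : EisensteinRoot F p hp) {e : ℕ}, D.poly = X ^ e - C (p : ℤ_[p]) →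
      ∀ {K₀ : Type} [Field K₀] [CharZero K₀] [Algebra K₀ F] (W₀ : WeierstrassCurve K₀) [W₀.IsElliptic]
      (a b : ℤ_[p]) (r₄ r₆ t₄ t₆ : ℕ),
      (p = 5 ∧ (e = 3 ∧ r₄ = 1 ∧ r₆ = 0 ∧ t₄ = 1 ∧ t₆ = 0 ∨ e = 6 ∧ r₄ = 4 ∧ r₆ = 0 ∧ t₄ = 2 ∧ t₆ = 0) ∨
        p = 7 ∧ e = 4 ∧ r₄ = 0 ∧ r₆ = 2 ∧ t₄ = 0 ∧ t₆ = 1) →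
      3 * r₄ = e * t₄ → 2 * r₆ = e * t₆ → IsUnit (64 * a ^ 3 * (p : ℤ_[p]) ^ t₄ + 432 * b ^ 2 * (p : ℤ_[p]) ^ t₆) →
      W₀.baseChange F = (⟨0, 0, 0, AdjoinRoot.of D.poly a * AdjoinRoot.root D.poly ^ r₄,
        AdjoinRoot.of D.poly b * AdjoinRoot.root D.poly ^ r₆⟩ : WeierstrassCurve D.Coeff).map (EisensteinRoot.Coeff.toF D) →
      GaloisRep.IsDeRham (bdRPeriodRingData (F := F) (p := p) hp) (restrictedRationalTateRep W₀ F p)) →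
    ∀ (W : WeierstrassCurve ℚ) [W.IsElliptic] [W.IsGloballyMinimal] (p : ℕ) [Fact p.Prime],
      (p = 5 ∨ p = 7) → Addv W p → Irr W p →
      (∀ (v : HeightOneSpectrum ℤ) (n : ℕ), natGenerator v = p → W.kodairaSymbolAt v ≠ KodairaSymbol.Istar n) →
      4 < padicValInt p W.minimalDiscriminantInt → ¬ (p = 5 ↔ padicValInt p W.minimalDiscriminantInt = 9) →
      ∀ (v : HeightOneSpectrum (𝓞 ℚ)), ((p : ℕ) : 𝓞 ℚ) ∈ v.asIdeal →
      ∀ [CharZero (v.adicCompletion ℚ)] [Fact (¬ IsUnit (p : integerC (v.adicCompletion ℚ)))]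
        [IsAdicComplete (Ideal.span {(p : integerC (v.adicCompletion ℚ))}) (integerC (v.adicCompletion ℚ))]
        (hp' : valuation (v.adicCompletion ℚ) p < 1) [Algebra ℚ_[p] (v.adicCompletion ℚ)],
        GaloisRep.IsDeRham (bdRPeriodRingData (F := v.adicCompletion ℚ) (p := p) hp')
          (restrictedRationalTateRep W (v.adicCompletion ℚ) p) := by
  intro hR W _ _ p _ hp57 hadd _ hIstar h4 hcell v hpv _ _ _ hp' _
  have hpr : p.Prime := Fact.out
  have hp5 : 5 ≤ p := by rcases hp57 with rfl | rfl <;> norm_num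
  have hgen : Rat.HeightOneSpectrum.natGenerator (placeOf p) = p :=
    congrArg Subtype.val ((Rat.HeightOneSpectrum.primesEquiv (R := ℤ)).apply_symm_apply ⟨p, Fact.out⟩)
  have hI : ∀ n : ℕ, W.kodairaSymbolAt (placeOf p) ≠ .Istar n := fun n ↦ hIstar (placeOf p) n hgen
  obtain ⟨hj, hvΔ⟩ := padicValRat_j_nonneg_and_mem_of_starred W p hp5 hadd hI h4
  rcases hp57 with rfl | rfl
  · have h9 : padicValInt 5 W.minimalDiscriminantInt ≠ 9 := fun h ↦ hcell ⟨fun _ ↦ h, fun _ ↦ rfl⟩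
    rcases hvΔ with h8 | h9' | h10
    · obtain ⟨K', _, _, α, v', hαe, hv'⟩ := exists_numberField_pow_eq_prime (e := 3) (by norm_num) hpr
      exact isDeRham_adicCompletion_rat_of_model_of_explicitCapstone hR W 5 (Or.inl rfl) hj (e := 3) (k := 2) (m := 3)
        (n := 4) (r₄ := 1) (r₆ := 0) (t₄ := 1) (t₆ := 0) (by norm_num) (by norm_num) (by norm_num) (by norm_num)
        (by norm_num) (by rw [h8]) (by rw [h8]) (by norm_num) (by norm_num) (Or.inl ⟨rfl, Or.inl ⟨rfl, rfl, rfl, rfl, rfl⟩⟩)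
        hαe v' hv' v hpv hp'
    · exact absurd h9' h9
    · obtain ⟨K', _, _, α, v', hαe, hv'⟩ := exists_numberField_pow_eq_prime (e := 6) (by norm_num) hpr
      exact isDeRham_adicCompletion_rat_of_model_of_explicitCapstone hR W 5 (Or.inl rfl) hj (e := 6) (k := 5) (m := 4)
        (n := 5) (r₄ := 4) (r₆ := 0) (t₄ := 2) (t₆ := 0) (by norm_num) (by norm_num) (by norm_num) (by norm_num)
        (by norm_num) (by rw [h10]) (by rw [h10]) (by norm_num) (by norm_num)
        (Or.inl ⟨rfl, Or.inr ⟨rfl, rfl, rfl, rfl, rfl⟩⟩) hαe v' hv' v hpv hp'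
  · have h9 : padicValInt 7 W.minimalDiscriminantInt = 9 := by
      by_contra h; exact hcell ⟨fun h7 ↦ by norm_num at h7, fun h9 ↦ absurd h9 h⟩
    obtain ⟨K', _, _, α, v', hαe, hv'⟩ := exists_numberField_pow_eq_prime (e := 4) (by norm_num) hpr
    exact isDeRham_adicCompletion_rat_of_model_of_explicitCapstone hR W 7 (Or.inr rfl) hj (e := 4) (k := 3) (m := 3)
      (n := 5) (r₄ := 0) (r₆ := 2) (t₄ := 0) (t₆ := 1) (by norm_num) (by norm_num) (by norm_num) (by norm_num)
      (by norm_num) (by rw [h9]) (by rw [h9]) (by norm_num) (by norm_num) (Or.inr ⟨rfl, rfl, rfl, rfl, rfl, rfl⟩)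
      hαe v' hv' v hpv hp'

/-- **K★ `StarredOptimalManinUnitFiveSeven` BY NAME, GRANTED {P1, hT₂, the explicit-model capstone `hR'`}** — the de Rham input on the
(G)-ordinary cells is a tree theorem, on the supersingular cells it is `isDeRham_supersingularCells_of_explicitCapstone`.
CONDITIONAL; the item is not closed by this. [cite: Kato2004Asterisque, (8.1.3) (p. 180), Thm. 9.7 (p. 189)]
[cite: Fontaine1982FormesDifferentielles, §5] [cite: EdixhovenManin1991, Thm. 3] -/
theorem starredOptimalManinUnitFiveSeven_of_sl2NeronValues_of_explicitCapstone
    (hT₂ : exists_smul_range_expStarCoord_tower_iff_trace_log) (hP1 : exists_member_sl2ZetaElement_neron_values) :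
    (∀ {F : Type} [Field F] [ValuativeRel F] [TopologicalSpace F] [IsNonarchimedeanLocalField F] [CharZero F]
      {p : ℕ} [Fact p.Prime] [Fact (¬ IsUnit (p : integerC F))] [IsAdicComplete (Ideal.span {(p : integerC F)}) (integerC F)]
      (hp : valuation F p < 1) [Algebra ℚ_[p] F] (D : EisensteinRoot F p hp) {e : ℕ}, D.poly = X ^ e - C (p : ℤ_[p]) →
      ∀ {K₀ : Type} [Field K₀] [CharZero K₀] [Algebra K₀ F] (W₀ : WeierstrassCurve K₀) [W₀.IsElliptic]
      (a b : ℤ_[p]) (r₄ r₆ t₄ t₆ : ℕ),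
      (p = 5 ∧ (e = 3 ∧ r₄ = 1 ∧ r₆ = 0 ∧ t₄ = 1 ∧ t₆ = 0 ∨ e = 6 ∧ r₄ = 4 ∧ r₆ = 0 ∧ t₄ = 2 ∧ t₆ = 0) ∨
        p = 7 ∧ e = 4 ∧ r₄ = 0 ∧ r₆ = 2 ∧ t₄ = 0 ∧ t₆ = 1) →
      3 * r₄ = e * t₄ → 2 * r₆ = e * t₆ → IsUnit (64 * a ^ 3 * (p : ℤ_[p]) ^ t₄ + 432 * b ^ 2 * (p : ℤ_[p]) ^ t₆) →
      W₀.baseChange F = (⟨0, 0, 0, AdjoinRoot.of D.poly a * AdjoinRoot.root D.poly ^ r₄,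
        AdjoinRoot.of D.poly b * AdjoinRoot.root D.poly ^ r₆⟩ : WeierstrassCurve D.Coeff).map (EisensteinRoot.Coeff.toF D) →
      GaloisRep.IsDeRham (bdRPeriodRingData (F := F) (p := p) hp) (restrictedRationalTateRep W₀ F p)) →
    Summit.BirchSwinnertonDyer.BirchSwinnertonDyer.Theses.EdixhovenFibreFiveSeven.StarredOptimalManinUnitFiveSeven := fun hR ↦
  starredOptimalManinUnitFiveSeven_of_sl2NeronValues_of_isDeRham_supersingularCells hT₂ hP1
    (fun W _ _ p _ hp57 hadd hirr hIstar h4 hcell v hpv _ _ _ hp' _ ↦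
      isDeRham_supersingularCells_of_explicitCapstone hR W p hp57 hadd hirr hIstar h4 hcell v hpv hp')

end Summit.BirchSwinnertonDyer.BirchSwinnertonDyer.Theorems.StarredOptimalManinUnitFiveSevenSupersingularCellsExplicit

end
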